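import Literature.NumberTheory.DiophantineGeometry.PairWordPolynomials
import Literature.NumberTheory.DiophantineGeometry.SliceRepresentation
import Literature.NumberTheory.DiophantineGeometry.WordHighestWeightSpecht
import Literature.NumberTheory.DiophantineGeometry.DetStabilizerKronecker
import Literature.Computability.AlgebraicComplexity.OrbitClosureWeights
import Literature.NumberTheory.DiophantineGeometry.SymmetricGroupRepsKroneckerCharacterProofs
import Literature.NumberTheory.DiophantineGeometry.SchurWeylPlethysmRenameProofs
import HarnessLib

/-!
# BLMW's Kronecker bound for the determinant orbit closure — discharge of
# `orbitMultiplicity_det_le_kroneckerCoeff`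

`Literature.NumberTheory.DiophantineGeometry.SchurWeylPlethysm` records as a named fact
(`Literature.CplxAlg.orbitMultiplicity_det_le_kroneckerCoeff : Prop`) that over a field `k` of
characteristic zero, for a partition `λ ⊢ m·d` with at most `m²` parts, the multiplicity of the
highest weight `λ* = (Weight.dualOfPartition (m*m) λ).toMatIdx` in the coordinate ring
`k[Δ(det_m)]` of the orbit closure of the determinant (G20's `orbitCoordRep (detFormLex k m) m`)
is at most the rectangular Kronecker coefficient `g(λ, m × d, m × d)`. This is
P. Bürgisser, J. M. Landsberg, L. Manivel, J. Weyman, *An overview of mathematical issues arising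
in the geometric complexity theory approach to VP ≠ VNP*, SIAM J. Comput. 40 (2011), §5.2,
Prop. 5.2.1 (= arXiv:0907.2850, Prop. 5.1): with `W = E ⊗ F`, `E, F = ℂ^n`,
"`ℂ[GL(W)·det_n] = ⊕_δ ⊕_{|π| = nδ} (S_πW^*)^{⊕ k_{δ^n,δ^n,π}}`,
`ℂ[\overline{GL(W)·det_n}]_δ ⊆ ⊕_{|π| = nδ} (S_πW^*)^{⊕ k_{δ^n,δ^n,π}}`", proved there from the
algebraic Peter–Weyl theorem and the stabilizer `GL(W)(det_n) = S(GL(E) × GL(F)) ⋊ ℤ₂`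
("To have a trivial `SL(E) × SL(F)` action on `S_μE ⊗ S_νF`, we need `μ = ν = (δ^n)`").
This file proves the fact (`orbitMultiplicity_det_le_kroneckerCoeff_holds`) for every field of
characteristic zero, exactly as stated.

## Proof

Let `N = m²`, `D = m d`, `B ⊂ GL_N` the upper triangular Borel, `χ = λ*` (`∑ χ = -D`),
`E = F = k^m`, `□ = (d, …, d)` (`m` parts) = `Nat.Partition.rectangle m d`.

0. *Unimodular Borel invariants of `E^{⊗D}` are `HW_□`* (§0,
   `unimodularBorelInvariants_eq_highestWeightSpace`): `□(b) = det(b)^d = 1` on unimodular `b`;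
   conversely the diagonal `diag(…, 2, …, 2⁻¹, …) ∈ SL_m` forces the content of every word in the
   support of an invariant to be constant `= (d, …, d)`, and an upper triangular `g` factors as
   `t u`, `t` diagonal, `u` unimodular. Hence the `𝔖_D`-character of the Kronecker invariants
   `kronInvariants k m D` (vectors of `(E ⊗ F)^{⊗D}` fixed by all `a ⊗ b`, `a, b` upper triangular
   unimodular, `DetStabilizerKronecker`) is `χ^□ · χ^□` (`character_kronInvariantsPermRep`, via the
   word splitting, `sliceRepEquiv` and `character_hwPermRep`).

1. *From the orbit closure to polynomials on `Mat_N`* (`orbitCoordToPoly`, any `f`, `σ`): over an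
   infinite field `I(GL·f)` is the kernel of the generic orbit map `F ↦ (A ↦ F(A · f))`
   (`orbitVanishingIdeal_eq_ker_genericOrbitMap`), so `k[Δ_m[f]] ↪ k[Mat_σ]`. A `B`-semi-invariant
   `x` of weight `χ` goes to a polynomial `P` with `P(b g) = χ(b)⁻¹ P(g)` (`b ∈ B`, `g ∈ GL`),
   `P(g h) = P(g)` for `h` in the stabilizer of `f`, and — testing scalar `b` — `P(t g) = t^D P(g)`,
   whence `P` is homogeneous of degree `D` (`isHomogeneous_of_eval_smul_eq`, `PairWordPolynomials`).
2. *Matrix coefficients* (`PairWordPolynomials`): `P = pairPoly L` for a unique `𝔖_D`-invariant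
   coefficient matrix `L` indexed by pairs of words, and the two (semi-)invariances become:
   every column of `L` lies in `Y = {y | bᵀ y = χ(b)⁻¹ y}` and every row in
   `X = {x | h x = x, h ∈ H}` (`exists_mem_boundSpace`), for any family `H` of stabilizing elements.
   Hence `mult ≤ dim T`, `T` = invariant `L` with columns in `Y`, rows in `X` (`boundSpace`), after
   transporting along the order isomorphism `Fin (m*m) ≃o MatIdx m` (`transportPoly`).
3. *Counting* (`SliceRepresentation`): `T ≅ (Y ⊗ X)^{𝔖_D}`, so `D! · dim T = ∑_τ χ_Y(τ) χ_X(τ)`.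
4. *The two characters*: `Y ≅ HW_λ((k^N)^{⊗D}) ≅ S^λ` as `𝔖_D`-modules (letter reversal `w₀` and
   the Specht isomorphism, `WordHighestWeightSpecht`), so `χ_Y = χ^λ`; with
   `H = {a ⊗ b : a, b upper triangular unimodular} ⊂ Stab(det_m)` (`(a ⊗ b)·det = det a det b det`,
   `DetStabilizerKronecker`), `X ≅ HW_□(E^{⊗D}) ⊗ HW_□(F^{⊗D}) ≅ S^□ ⊗ S^□` (§0), so
   `χ_X = (χ^□)²`.
5. `∑_τ χ^λ χ^□ χ^□ = D! · g(λ, □, □)` (`kroneckerCoeff_eq_sum_spechtCharacter_holds`), hence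
   `mult_{λ*} k[Δ(det_m)] ≤ dim T = g(λ, □, □)`.

Steps 1–3 are BLMW's "`ℂ[\overline{GL·det}] ⊆ ℂ[GL·det] = ℂ[GL]^{H}`" made elementary (no
Peter–Weyl decomposition is needed for an upper bound: injectivity of `L ↦ pairPoly L` on
invariant matrices, Fulton–Harris Lemma 6.23, suffices); step 4 is their computation of
`(S_π(E ⊗ F))^{SL(E)×SL(F)}` restricted to the Borel subgroups of `SL(E) × SL(F)`, which already
cut the invariants down to `k_{δ^n,δ^n,π}`.

## References

* P. Bürgisser, J. M. Landsberg, L. Manivel, J. Weyman, SIAM J. Comput. 40(4) (2011) 1179–1209,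
  doi:10.1137/090765328, §5.2 Prop. 5.2.1; arXiv:0907.2850 §5.2 Prop. 5.1 (held copy, p. 9).
  [cite: BLMW2011, §5.2 Prop. 5.2.1]
* W. Fulton, J. Harris, *Representation Theory. A First Course*, GTM 129 (1991), Lemma 6.23,
  Thm. 6.3, Ex. 4.51, Ex. 6.11. [cite: FultonHarrisGTM129, Lemma 6.23]

## Design

`namespace Literature.CplxAlg`. §0 writes the degree as `m * d` so that `Nat.Partition.rectangle m d` and
`spechtCharacter k (Nat.Partition.rectangle m d)` typecheck without casts. §1 is stated for an
arbitrary finite linearly ordered `σ` and any `f`;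
§2–§3 for the alphabet `Fin N` (where the word model lives) together with an order isomorphism
`e : Fin N ≃o σ` used to transport the polynomial (`transportPoly`) and the group (`reindexGL`);
§4 specialises to `σ = MatIdx m`, `e = matIdxEquiv m`, `f = detFormLex k m`. The statement file is
untouched: users holding `(h : orbitMultiplicity_det_le_kroneckerCoeff)` feed
`orbitMultiplicity_det_le_kroneckerCoeff_holds`.
-/

noncomputable section

open MvPolynomial
open scoped BigOperators Matrix Kronecker TensorProduct

namespace Literature.NumberTheory.DiophantineGeometry

/-! ### §0 The rectangular weight `(d, …, d)` and the unimodular Borel invariants -/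

section Rectangle

variable (m d : ℕ)

/-- The parts of the rectangular partition `(d, …, d)` are `m` copies of `d` (none if `d = 0`).
Declared in Mathlib's `Nat.Partition` namespace for dot notation, next to
`Nat.Partition.rectangle` of `PartitionTableaux` (H21 convention: deliberate extension).
[folklore] -/
theorem _root_.Nat.Partition.parts_rectangle :
    (Nat.Partition.rectangle m d).parts = (Multiset.replicate m d).filter (· ≠ 0) :=
  rfl

/-- The rectangular partition `(d, …, d)` has at most `m` parts. Declared in Mathlib's
`Nat.Partition` namespace for dot notation (H21 convention: deliberate extension). [folklore] -/
theorem _root_.Nat.Partition.card_parts_rectangle_le : (Nat.Partition.rectangle m d).parts.card ≤ m := by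
  rw [Nat.Partition.parts_rectangle]
  exact (Multiset.card_le_card (Multiset.filter_le _ _)).trans (by rw [Multiset.card_replicate])

/-- The sorted parts of the rectangular partition `(d, …, d)`, `d ≠ 0`, are the constant list.
Declared in Mathlib's `Nat.Partition` namespace for dot notation (H21 convention: deliberate
extension). [folklore] -/
theorem _root_.Nat.Partition.sortedParts_rectangle (hd : d ≠ 0) :
    (Nat.Partition.rectangle m d).sortedParts = List.replicate m d := by
  rw [Nat.Partition.sortedParts, Nat.Partition.parts_rectangle,
    Multiset.filter_eq_self.mpr (fun a ha => by rwa [Multiset.eq_of_mem_replicate ha]),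
    ← Multiset.coe_replicate, Multiset.coe_sort]
  exact List.mergeSort_eq_self _ ((List.pairwise_replicate.mpr (Or.inr le_rfl)))

/-- **The weight of the rectangular partition is constant**: `(□_1, …, □_m) = (d, …, d)`.
Fulton–Harris §15.5 (`det^d`). [folklore] -/
theorem Weight.ofPartition_rectangle_apply (i : Fin m) :
    Weight.ofPartition m (Nat.Partition.rectangle m d) i = d := by
  rw [Weight.ofPartition]
  by_cases hd : d = 0
  · subst hd
    have h0 : (Nat.Partition.rectangle m 0).sortedParts = [] := by
      rw [Nat.Partition.sortedParts, Nat.Partition.parts_rectangle,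
        Multiset.filter_eq_nil.mpr (fun a ha => by simp [Multiset.eq_of_mem_replicate ha])]
      simp
    rw [h0]
    simp
  · rw [Nat.Partition.sortedParts_rectangle m d hd, List.getD_replicate _ i.2]

/-- The weight of the rectangular partition as a function: the constant `d`. [folklore] -/
theorem Weight.ofPartition_rectangle :
    Weight.ofPartition m (Nat.Partition.rectangle m d) = fun _ => (d : ℤ) :=
  funext (Weight.ofPartition_rectangle_apply m d)

variable {m d} {k : Type*} [Field k]

/-- **`□(g) = det(g)^d`** on upper triangular `g` (the determinant of a triangular matrix is the
product of its diagonal). Fulton–Harris §15.5. [folklore] -/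
theorem weightChar_ofPartition_rectangle {g : GL (Fin m) k} (hg : IsUpperTriangular g) :
    weightChar (Weight.ofPartition m (Nat.Partition.rectangle m d)) g =
      (g : Matrix (Fin m) (Fin m) k).det ^ d := by
  rw [Weight.ofPartition_rectangle, weightChar, Matrix.det_of_upperTriangular hg, ← Finset.prod_pow]
  simp only [zpow_natCast]

end Rectangle

/-! ### Unimodular Borel invariants are the highest-weight vectors of weight `□` -/

section Unimodular

variable (k : Type*) [Field k] {m d : ℕ}

/-- Highest-weight vectors of the rectangular weight are fixed by the unimodular upper triangular
matrices (`□(b) = det(b)^d = 1`). BLMW 2011 §5.2. [folklore] -/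
theorem highestWeightSpace_rectangle_le_unimodularBorelInvariants :
    highestWeightSpace (wordRep k m (m * d)) (Weight.ofPartition m (Nat.Partition.rectangle m d)) ≤
      unimodularBorelInvariants k m (m * d) := by
  intro y hy a ha ha1
  rw [hy a ha, weightChar_ofPartition_rectangle ha, ha1, one_pow, one_smul]

/-- A product over `Fin m` of a function equal to `1` away from two indices `i ≠ j` is the
product of its two special values. [folklore] -/
theorem prod_eq_mul_of_ne {M : Type*} [CommMonoid M] {i j : Fin m} (hij : i ≠ j) (f : Fin m → M)
    (hf : ∀ l, l ≠ i → l ≠ j → f l = 1) : ∏ l, f l = f i * f j :=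
  Finset.prod_eq_mul i j hij (fun l _ hl => hf l hl.1 hl.2) (fun h => absurd (Finset.mem_univ i) h)
    fun h => absurd (Finset.mem_univ j) h

/-- **Content is constant on the support of a unimodular Borel invariant** (characteristic zero):
the diagonal matrix with `2` at `i`, `2⁻¹` at `j` and `1` elsewhere has determinant `1` and acts
on `e_w` by `2^{c_i(w) - c_j(w)}`. BLMW 2011 §5.2 (`SL(E)`-invariants and the torus);
Fulton–Harris §15.3. [folklore] -/
theorem wordContent_eq_of_mem_unimodularBorelInvariants [CharZero k] {D : ℕ} {y : Word m D → k}
    (hy : y ∈ unimodularBorelInvariants k m D) {w : Word m D} (hw : y w ≠ 0) (i j : Fin m) :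
    wordContent w i = wordContent w j := by
  classical
  by_cases hij : i = j
  · rw [hij]
  -- the torus element `x = diag(…, 2 (at i), …, 2⁻¹ (at j), …)`
  set x : Fin m → k := fun l => if l = i then 2 else if l = j then 2⁻¹ else 1 with hx
  have hxi : x i = 2 := by simp [hx]
  have hxj : x j = 2⁻¹ := by simp [hx, Ne.symm hij]
  have hxl : ∀ l, l ≠ i → l ≠ j → x l = 1 := fun l hli hlj => by simp [hx, hli, hlj]
  have two_ne : (2 : k) ≠ 0 := two_ne_zero
  have hdet : (Matrix.diagonal x).det = 1 := by
    rw [Matrix.det_diagonal, prod_eq_mul_of_ne hij x hxl, hxi, hxj, mul_inv_cancel₀ two_ne]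
  have hdet0 : (Matrix.diagonal x).det ≠ 0 := by rw [hdet]; exact one_ne_zero
  set s : GL (Fin m) k := Matrix.GeneralLinearGroup.mkOfDetNeZero _ hdet0 with hs
  have hsU : IsUpperTriangular s := by
    change ((s : GL (Fin m) k) : Matrix (Fin m) (Fin m) k).BlockTriangular id
    rw [hs, Matrix.GeneralLinearGroup.val_mkOfDetNeZero]
    exact Matrix.blockTriangular_diagonal x
  have hsdet : ((s : GL (Fin m) k) : Matrix (Fin m) (Fin m) k).det = 1 := by
    rw [hs, Matrix.GeneralLinearGroup.val_mkOfDetNeZero, hdet]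
  have key := congr_fun (hy s hsU hsdet) w
  rw [hs, wordRep_diagonal_apply, prod_eq_prod_pow_wordContent,
    prod_eq_mul_of_ne hij _ (fun l hli hlj => by rw [hxl l hli hlj, one_pow]), hxi, hxj] at key
  -- `2^{c_i} (2⁻¹)^{c_j} y w = y w`, `y w ≠ 0`
  have h1 : (2 : k) ^ wordContent w i * (2⁻¹ : k) ^ wordContent w j = 1 :=
    (mul_eq_right₀ hw).mp key
  have h2 : (2 : k) ^ ((wordContent w i : ℤ) - wordContent w j) = (2 : k) ^ (0 : ℤ) := by
    rw [zpow_sub₀ two_ne, zpow_natCast, zpow_natCast, div_eq_mul_inv, ← inv_pow, h1, zpow_zero]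
  have h3 := two_zpow_injective k h2
  omega

/-- On the support of a unimodular Borel invariant of `E^{⊗ m d}` every word has content
`(d, …, d)` (the contents are constant and add up to `m d`). [folklore] -/
theorem wordContent_eq_of_mem_unimodularBorelInvariants_rectangle [CharZero k]
    {y : Word m (m * d) → k} (hy : y ∈ unimodularBorelInvariants k m (m * d)) {w : Word m (m * d)}
    (hw : y w ≠ 0) (i : Fin m) : wordContent w i = d := by
  have hsum := sum_wordContent w
  rw [Finset.sum_congr rfl fun j _ => wordContent_eq_of_mem_unimodularBorelInvariants k hy hw j i,
    Finset.sum_const, Finset.card_univ, Fintype.card_fin, smul_eq_mul] at hsum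
  exact Nat.eq_of_mul_eq_mul_left (Fin.pos i) hsum

/-- **A diagonal matrix acts on a unimodular Borel invariant of `E^{⊗ m d}` by `(∏ tᵢ)^d`** (every
word in the support has content `(d, …, d)`). [folklore] -/
theorem wordRep_diagonal_of_mem_unimodularBorelInvariants [CharZero k] {y : Word m (m * d) → k}
    (hy : y ∈ unimodularBorelInvariants k m (m * d)) (t : Fin m → k)
    (ht : (Matrix.diagonal t).det ≠ 0) :
    wordRep k m (m * d) (Matrix.GeneralLinearGroup.mkOfDetNeZero _ ht) y = (∏ i, t i) ^ d • y := by
  funext w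
  rw [wordRep_diagonal_apply, Pi.smul_apply, smul_eq_mul]
  by_cases hw : y w = 0
  · rw [hw, mul_zero, mul_zero]
  · rw [prod_eq_prod_pow_wordContent, ← Finset.prod_pow]
    congr 1
    exact Finset.prod_congr rfl fun i _ => by
      rw [wordContent_eq_of_mem_unimodularBorelInvariants_rectangle k hy hw i]

/-- **Unimodular Borel invariants of `E^{⊗ m d}` are highest-weight vectors of weight `□`**
(characteristic zero): factor an upper triangular `g = t u` with `t = diag(g)` and `u`
unimodular upper triangular; `u` fixes `y`, and `t` acts by `det(t)^d = □(g)`. BLMW 2011 §5.2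
("we need `μ = (δ^n)`"). [cite: BLMW2011, §5.2 Prop. 5.2.1] -/
theorem unimodularBorelInvariants_le_highestWeightSpace_rectangle [CharZero k] :
    unimodularBorelInvariants k m (m * d) ≤
      highestWeightSpace (wordRep k m (m * d)) (Weight.ofPartition m (Nat.Partition.rectangle m d)) := by
  intro y hy g hg
  -- the diagonal part `t` of `g`
  set δ : Fin m → k := fun i => (g : Matrix (Fin m) (Fin m) k) i i with hδ
  have hδ0 : ∀ i, δ i ≠ 0 := fun i => diag_ne_zero_of_isUpperTriangular hg i
  have hdetg : (g : Matrix (Fin m) (Fin m) k).det = ∏ i, δ i := Matrix.det_of_upperTriangular hg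
  have hprod : (∏ i, δ i) ≠ 0 := Finset.prod_ne_zero_iff.mpr fun i _ => hδ0 i
  have ht0 : (Matrix.diagonal δ).det ≠ 0 := by rwa [Matrix.det_diagonal]
  set t : GL (Fin m) k := Matrix.GeneralLinearGroup.mkOfDetNeZero _ ht0 with ht
  have htcoe : ((t : GL (Fin m) k) : Matrix (Fin m) (Fin m) k) = Matrix.diagonal δ := by
    rw [ht, Matrix.GeneralLinearGroup.val_mkOfDetNeZero]
  have htU : IsUpperTriangular t := by
    change ((t : GL (Fin m) k) : Matrix (Fin m) (Fin m) k).BlockTriangular id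
    rw [htcoe]
    exact Matrix.blockTriangular_diagonal δ
  -- the unimodular part `u = t⁻¹ g`
  set u : GL (Fin m) k := t⁻¹ * g with hu
  have huU : IsUpperTriangular u :=
    (borelSubgroup (Fin m) k).mul_mem ((borelSubgroup (Fin m) k).inv_mem htU) hg
  have hudet : ((u : GL (Fin m) k) : Matrix (Fin m) (Fin m) k).det = 1 := by
    rw [hu, Units.val_mul, Matrix.det_mul, Matrix.coe_units_inv, Matrix.det_nonsing_inv, htcoe,
      Matrix.det_diagonal, hdetg, Ring.inverse_mul_cancel _ (IsUnit.mk0 _ hprod)]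
  have hg' : g = t * u := by rw [hu, mul_inv_cancel_left]
  rw [hg', map_mul, Module.End.mul_apply, hy u huU hudet, ht,
    wordRep_diagonal_of_mem_unimodularBorelInvariants k hy δ ht0, ← hdetg, ← ht, ← hg',
    weightChar_ofPartition_rectangle hg]

/-- **`E^{⊗ m d}`: unimodular Borel invariants = `HW_□`** (characteristic zero). BLMW 2011 §5.2.
[cite: BLMW2011, §5.2 Prop. 5.2.1] -/
theorem unimodularBorelInvariants_eq_highestWeightSpace [CharZero k] :
    unimodularBorelInvariants k m (m * d) =
      highestWeightSpace (wordRep k m (m * d)) (Weight.ofPartition m (Nat.Partition.rectangle m d)) :=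
  le_antisymm (unimodularBorelInvariants_le_highestWeightSpace_rectangle k)
    (highestWeightSpace_rectangle_le_unimodularBorelInvariants k)

end Unimodular

/-! ### The `𝔖_D`-character of the Kronecker invariants -/

section Character

variable (k : Type*) [Field k] (m : ℕ) {D : ℕ}

/-- On functions of pairs of words the transported tensor product of two copies of the position
action of `𝔖_D` is the simultaneous permutation of the positions: `g · M = M ∘ (∘τ × ∘τ)`.
[folklore] -/
theorem pairRep_wordPermRep_apply (τ : Equiv.Perm (Fin D)) (M : Word m D × Word m D → k) :
    pairRep (wordPermRep k m D) (wordPermRep k m D) τ M = pairPermAct k τ M := by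
  classical
  funext p
  rw [pairRep_apply_apply, pairPermAct_apply, Finset.sum_eq_single (p.1 ∘ ⇑τ, p.2 ∘ ⇑τ)]
  · simp only [wordPermRep_apply, wordPerm_single]
    have h1 : (p.1 ∘ ⇑τ) ∘ ⇑τ⁻¹ = p.1 := by funext q; simp
    have h2 : (p.2 ∘ ⇑τ) ∘ ⇑τ⁻¹ = p.2 := by funext q; simp
    rw [h1, h2, Pi.single_eq_same, Pi.single_eq_same, mul_one, mul_one]
  · intro q _ hq
    simp only [wordPermRep_apply, wordPerm_single]
    by_cases hq1 : q.1 ∘ ⇑τ⁻¹ = p.1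
    · have hq2 : q.2 ∘ ⇑τ⁻¹ ≠ p.2 := by
        intro hq2
        apply hq
        refine Prod.ext ?_ ?_
        · rw [← hq1]; funext r; simp
        · rw [← hq2]; funext r; simp
      rw [Pi.single_eq_of_ne (Ne.symm hq2), mul_zero, mul_zero]
    · rw [Pi.single_eq_of_ne (Ne.symm hq1), zero_mul, mul_zero]
  · exact fun h => absurd (Finset.mem_univ _) h

/-- The Kronecker invariants are stable under the permutations of the positions (which commute
with `GL_{m²}`). [folklore] -/
theorem wordPerm_mem_kronInvariants (τ : Equiv.Perm (Fin D)) {x : Word (m * m) D → k}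
    (hx : x ∈ kronInvariants k m D) : wordPerm k τ x ∈ kronInvariants k m D := by
  intro a b ha ha1 hb hb1
  rw [← wordPerm_wordRep, hx a b ha ha1 hb hb1]

/-- The representation of `𝔖_D` on the Kronecker invariants of `(E ⊗ F)^{⊗D}` (restriction of
`wordPermRep`). [folklore] -/
def kronInvariantsPermRep : Representation k (Equiv.Perm (Fin D)) (kronInvariants k m D) :=
  (wordPermRep k (m * m) D).subrepresentation (kronInvariants k m D)
    fun τ _ hx => wordPerm_mem_kronInvariants k m τ hx

/-- `kronInvariantsPermRep` acts as `wordPerm` on underlying functions (unfolding lemma).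
[folklore] -/
@[simp]
theorem coe_kronInvariantsPermRep_apply (τ : Equiv.Perm (Fin D)) (x : kronInvariants k m D) :
    ((kronInvariantsPermRep k m τ x : kronInvariants k m D) : Word (m * m) D → k) = wordPerm k τ x :=
  rfl

variable {m} (d : ℕ)

/-- The highest-weight space of the rectangular weight is stable under `𝔖_D`. [folklore] -/
theorem highestWeightSpace_le_comap_wordPermRep (χ : Weight (Fin m)) (τ : Equiv.Perm (Fin D)) :
    highestWeightSpace (wordRep k m D) χ ≤
      (highestWeightSpace (wordRep k m D) χ).comap (wordPermRep k m D τ) :=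
  fun _ hc => wordPerm_mem_highestWeightSpace τ hc

/-- **Kronecker invariants ≃ functions of pairs of words with slices in `HW_□`** (linear
isomorphism induced by the word splitting, characteristic zero). [folklore] -/
def kronInvariantsEquivSliceLinear [CharZero k] :
    kronInvariants k m (m * d) ≃ₗ[k]
      sliceSubmodule
        (highestWeightSpace (wordRep k m (m * d)) (Weight.ofPartition m (Nat.Partition.rectangle m d)))
        (highestWeightSpace (wordRep k m (m * d)) (Weight.ofPartition m (Nat.Partition.rectangle m d))) where
  toFun x := ⟨splitFun k m (m * d) x, by
    have h := (mem_kronInvariants_iff_slices k (x : Word (m * m) (m * d) → k)).mp x.2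
    rw [unimodularBorelInvariants_eq_highestWeightSpace] at h
    exact h⟩
  invFun M := ⟨(splitFun k m (m * d)).symm M, by
    rw [mem_kronInvariants_iff_slices, unimodularBorelInvariants_eq_highestWeightSpace,
      LinearEquiv.apply_symm_apply]
    exact M.2⟩
  map_add' _ _ := rfl
  map_smul' _ _ := rfl
  left_inv x := Subtype.ext ((splitFun k m (m * d)).symm_apply_apply _)
  right_inv M := Subtype.ext ((splitFun k m (m * d)).apply_symm_apply _)

/-- **Kronecker invariants ≃ slice representation `HW_□ ⊠ HW_□`** as representations of `𝔖_D`
(`D = m d`, characteristic zero). BLMW 2011 §5.2; Fulton–Harris Ex. 6.11. [folklore] -/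
def kronInvariantsEquivSlice [CharZero k] :
    (kronInvariantsPermRep k m (D := m * d)).Equiv
      (sliceRep (highestWeightSpace_le_comap_wordPermRep k
          (Weight.ofPartition m (Nat.Partition.rectangle m d)))
        (highestWeightSpace_le_comap_wordPermRep k
          (Weight.ofPartition m (Nat.Partition.rectangle m d)))) :=
  Representation.Equiv.mk (kronInvariantsEquivSliceLinear k d) fun τ => by
    apply LinearMap.ext
    intro x
    apply Subtype.ext
    change splitFun k m (m * d) (wordPerm k τ x) =
      pairRep (wordPermRep k m (m * d)) (wordPermRep k m (m * d)) τ (splitFun k m (m * d) x)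
    rw [splitFun_wordPerm, pairRep_wordPermRep_apply]

/-- **The `𝔖_{md}`-character of the Kronecker invariants of `(E ⊗ F)^{⊗ md}` is `χ^□ χ^□`**,
`□ = (d, …, d)` (`m` parts), in characteristic zero: `kronInvariantsEquivSlice`, `sliceRepEquiv`
(`χ_{Y ⊗ X} = χ_Y χ_X`) and `character_hwPermRep` (`HW_□ ≃ S^□`). This is the representation
theory behind `dim (S_π(E ⊗ F))^{SL(E)×SL(F)} = k_{δ^n,δ^n,π}` (BLMW 2011, proof of
Prop. 5.2.1). [cite: BLMW2011, §5.2 Prop. 5.2.1] -/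
theorem character_kronInvariantsPermRep [CharZero k] :
    (kronInvariantsPermRep k m (D := m * d)).character =
      spechtCharacter k (Nat.Partition.rectangle m d) * spechtCharacter k (Nat.Partition.rectangle m d) := by
  have hsq := highestWeightSpace_le_comap_wordPermRep k (D := m * d)
    (Weight.ofPartition m (Nat.Partition.rectangle m d))
  rw [Representation.char_iso (kronInvariantsEquivSlice k d)]
  have hslice := Representation.char_iso
    (V := ↥(highestWeightSpace (wordRep k m (m * d)) (Weight.ofPartition m (Nat.Partition.rectangle m d))) ⊗[k]
      ↥(highestWeightSpace (wordRep k m (m * d)) (Weight.ofPartition m (Nat.Partition.rectangle m d))))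
    (sliceRepEquiv hsq hsq)
  rw [← hslice, Representation.char_tensor]
  have hhw : ((wordPermRep k m (m * d)).subrepresentation _ hsq).character =
      spechtCharacter k (Nat.Partition.rectangle m d) :=
    character_hwPermRep k (Nat.Partition.rectangle m d) (Nat.Partition.card_parts_rectangle_le m d)
  rw [hhw]

end Character

/-! ### §1 From the coordinate ring of an orbit closure to polynomials on matrix space -/

section OrbitToPoly

variable {σ k : Type*} [Fintype σ] [LinearOrder σ] [Field k] (f : MvPolynomial σ k) (m : ℕ)

/-- **`k[Δ_m[f]] ↪ k[Mat_σ]`.** Over an infinite field the vanishing ideal `I(GL · f)` is the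
kernel of the generic orbit map `F ↦ (A ↦ F(A · f))` (`orbitVanishingIdeal_eq_ker_genericOrbitMap`),
so the generic orbit map descends to an injective `k`-algebra homomorphism of the coordinate
ring `k[Δ_m[f]] = k[Sym^m] ⧸ I(GL · f)` into the polynomial ring of the matrix space
(restriction of functions to the orbit, BLMW 2011 §5: "`ℂ[\overline{GL(W)·x}] ⊆ ℂ[GL(W)·x]`").
Mulmuley–Sohoni 2001 §4; BLMW 2011 §5.1–§5.2. [cite: BLMW2011, §5.2] -/
def orbitCoordToPoly [Infinite k] : Literature.Computability.AlgebraicComplexity.OrbitCoordRing f m →ₐ[k] MvPolynomial (σ × σ) k :=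
  Ideal.Quotient.liftₐ (Literature.Computability.AlgebraicComplexity.orbitVanishingIdeal f m) (Literature.Computability.AlgebraicComplexity.genericOrbitMap f m) fun F hF => by
    rw [Literature.Computability.AlgebraicComplexity.orbitVanishingIdeal_eq_ker_genericOrbitMap] at hF
    exact hF

/-- `orbitCoordToPoly` on the class of a polynomial function is the generic orbit map
(unfolding lemma). [folklore] -/
theorem orbitCoordToPoly_mk [Infinite k] (F : MvPolynomial (Literature.Computability.AlgebraicComplexity.DegIdx σ m) k) :
    orbitCoordToPoly f m (Ideal.Quotient.mk (Literature.Computability.AlgebraicComplexity.orbitVanishingIdeal f m) F) = Literature.Computability.AlgebraicComplexity.genericOrbitMap f m F :=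
  Ideal.Quotient.lift_mk _ _ _

/-- Values of `orbitCoordToPoly` at invertible matrices: `F ↦ (g ↦ F(g · f))`. [folklore] -/
theorem eval_orbitCoordToPoly_mk [Infinite k] (F : MvPolynomial (Literature.Computability.AlgebraicComplexity.DegIdx σ m) k) (g : GL σ k) :
    eval (fun ij : σ × σ => (g : Matrix σ σ k) ij.1 ij.2)
        (orbitCoordToPoly f m (Ideal.Quotient.mk (Literature.Computability.AlgebraicComplexity.orbitVanishingIdeal f m) F)) =
      aeval (Literature.Computability.AlgebraicComplexity.formCoeff m (Literature.Computability.AlgebraicComplexity.linSubstRep σ k g f)) F := by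
  rw [orbitCoordToPoly_mk, Literature.Computability.AlgebraicComplexity.eval_genericOrbitMap]
  rfl

/-- **`orbitCoordToPoly` is injective** (`I(GL · f) = ker` of the generic orbit map).
Mulmuley–Sohoni 2001 §4. [folklore] -/
theorem orbitCoordToPoly_injective [Infinite k] : Function.Injective (orbitCoordToPoly f m) := by
  intro x y hxy
  obtain ⟨F, rfl⟩ := Ideal.Quotient.mk_surjective x
  obtain ⟨G, rfl⟩ := Ideal.Quotient.mk_surjective y
  rw [orbitCoordToPoly_mk, orbitCoordToPoly_mk] at hxy
  rw [Ideal.Quotient.eq, Literature.Computability.AlgebraicComplexity.orbitVanishingIdeal_eq_ker_genericOrbitMap, RingHom.mem_ker, map_sub]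
  exact sub_eq_zero.mpr hxy

/-- A representative `F` of a `B`-semi-invariant class of weight `χ` in `k[Δ_m[f]]` is
semi-invariant modulo the ideal: `b · F - χ(b) F ∈ I(GL · f)` for upper triangular `b`.
(As `exists_lift_of_mem_highestWeightSpace_orbitCoordRep`, for an arbitrary representative.)
Mulmuley–Sohoni 2001 §5. [folklore] -/
theorem sub_mem_of_mk_mem_highestWeightSpace {F : MvPolynomial (Literature.Computability.AlgebraicComplexity.DegIdx σ m) k} {χ : Weight σ}
    (hx : Ideal.Quotient.mk (Literature.Computability.AlgebraicComplexity.orbitVanishingIdeal f m) F ∈ highestWeightSpace (Literature.Computability.AlgebraicComplexity.orbitCoordRep f m) χ)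
    {b : GL σ k} (hb : IsUpperTriangular b) :
    Literature.Computability.AlgebraicComplexity.coordSubst m b F - weightChar χ b • F ∈ Literature.Computability.AlgebraicComplexity.orbitVanishingIdeal f m := by
  rw [← Ideal.Quotient.eq]
  have h := hx b hb
  rw [Literature.Computability.AlgebraicComplexity.orbitCoordRep_apply, Literature.Computability.AlgebraicComplexity.orbitCoordSubst_mk] at h
  rw [h]
  exact (map_smul (Ideal.Quotient.mkₐ k (Literature.Computability.AlgebraicComplexity.orbitVanishingIdeal f m)) (weightChar χ b) F).symm

/-- On the Borel subgroup the weight character of an inverse is the inverse. [folklore] -/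
theorem weightChar_inv (χ : Weight σ) {b : GL σ k} (hb : IsUpperTriangular b) :
    weightChar χ b⁻¹ = (weightChar χ b)⁻¹ := by
  have h := weightChar_mul χ hb ((borelSubgroup σ k).inv_mem hb)
  rw [mul_inv_cancel, weightChar_one] at h
  exact (eq_inv_of_mul_eq_one_right h.symm)

/-- **Left semi-invariance** of the polynomial of a `B`-semi-invariant class:
`P(b g) = χ(b)⁻¹ P(g)` for upper triangular `b` and invertible `g` (from
`F(b⁻¹ · q) = χ(b) F(q)` on the orbit, `aeval_formCoeff_inv_eq_of_sub_mem`).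
BLMW 2011 §5.2 (left translation on `ℂ[GL·x]`). [folklore] -/
theorem eval_orbitCoordToPoly_mul_left [Infinite k] {F : MvPolynomial (Literature.Computability.AlgebraicComplexity.DegIdx σ m) k}
    {χ : Weight σ}
    (hx : Ideal.Quotient.mk (Literature.Computability.AlgebraicComplexity.orbitVanishingIdeal f m) F ∈ highestWeightSpace (Literature.Computability.AlgebraicComplexity.orbitCoordRep f m) χ)
    {b : GL σ k} (hb : IsUpperTriangular b) (g : GL σ k) :
    eval (fun ij : σ × σ => ((b : Matrix σ σ k) * (g : Matrix σ σ k)) ij.1 ij.2)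
        (orbitCoordToPoly f m (Ideal.Quotient.mk (Literature.Computability.AlgebraicComplexity.orbitVanishingIdeal f m) F)) =
      (weightChar χ b)⁻¹ * eval (fun ij : σ × σ => (g : Matrix σ σ k) ij.1 ij.2)
        (orbitCoordToPoly f m (Ideal.Quotient.mk (Literature.Computability.AlgebraicComplexity.orbitVanishingIdeal f m) F)) := by
  have hb' : IsUpperTriangular b⁻¹ := (borelSubgroup σ k).inv_mem hb
  have h := Literature.Computability.AlgebraicComplexity.aeval_formCoeff_inv_eq_of_sub_mem (sub_mem_of_mk_mem_highestWeightSpace f m hx hb') g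
  rw [inv_inv, ← Module.End.mul_apply, ← map_mul, weightChar_inv χ hb] at h
  rw [← Units.val_mul, eval_orbitCoordToPoly_mk, eval_orbitCoordToPoly_mk, h]

/-- **Right invariance**: `P(g h) = P(g)` for `h` in the stabilizer of `f`. BLMW 2011 §5.2
(`ℂ[GL·x] = ℂ[GL]^{GL(x)}`). [folklore] -/
theorem eval_orbitCoordToPoly_mul_right [Infinite k] (F : MvPolynomial (Literature.Computability.AlgebraicComplexity.DegIdx σ m) k)
    {h : GL σ k} (hh : Literature.Computability.AlgebraicComplexity.linSubstRep σ k h f = f) (g : GL σ k) :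
    eval (fun ij : σ × σ => ((g : Matrix σ σ k) * (h : Matrix σ σ k)) ij.1 ij.2)
        (orbitCoordToPoly f m (Ideal.Quotient.mk (Literature.Computability.AlgebraicComplexity.orbitVanishingIdeal f m) F)) =
      eval (fun ij : σ × σ => (g : Matrix σ σ k) ij.1 ij.2)
        (orbitCoordToPoly f m (Ideal.Quotient.mk (Literature.Computability.AlgebraicComplexity.orbitVanishingIdeal f m) F)) := by
  rw [← Units.val_mul, eval_orbitCoordToPoly_mk, eval_orbitCoordToPoly_mk, map_mul,
    Module.End.mul_apply, hh]

omit [Fintype σ] [LinearOrder σ] in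
/-- `∏_i t^{χ_i} = t^{∑ χ_i}` for `t ≠ 0`. [folklore] -/
theorem prod_zpow_eq_zpow_sum {t : k} (ht : t ≠ 0) (χ : σ → ℤ) (s : Finset σ) :
    ∏ i ∈ s, t ^ χ i = t ^ ∑ i ∈ s, χ i := by
  classical
  induction s using Finset.induction_on with
  | empty => simp
  | insert a s ha ih => rw [Finset.prod_insert ha, Finset.sum_insert ha, ih, zpow_add₀ ht]

/-- **Scalars pin the degree**: the polynomial of a `B`-semi-invariant class of weight `χ` with
`∑ χ = -D` is homogeneous of degree `D` (test the scalar matrices `t·1 ∈ B`: `P(t g) = t^D P(g)`,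
then `isHomogeneous_of_eval_smul_eq`). BLMW 2011 §5.1 ("this inclusion respects degree");
Green, LNM 830, §2.2. [folklore] -/
theorem isHomogeneous_orbitCoordToPoly [CharZero k] {F : MvPolynomial (Literature.Computability.AlgebraicComplexity.DegIdx σ m) k}
    {χ : Weight σ}
    (hx : Ideal.Quotient.mk (Literature.Computability.AlgebraicComplexity.orbitVanishingIdeal f m) F ∈ highestWeightSpace (Literature.Computability.AlgebraicComplexity.orbitCoordRep f m) χ)
    {D : ℕ} (hsize : χ.size = -(D : ℤ)) :
    (orbitCoordToPoly f m (Ideal.Quotient.mk (Literature.Computability.AlgebraicComplexity.orbitVanishingIdeal f m) F)).IsHomogeneous D := by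
  apply isHomogeneous_of_eval_smul_eq
  intro g t ht
  set s : GL σ k := Literature.Computability.AlgebraicComplexity.torusElt (fun _ : σ => t) (fun _ => ht) with hs
  have hsU : IsUpperTriangular s := (Literature.Computability.AlgebraicComplexity.isDiagonalGL_torusElt _ _).isUpperTriangular
  have h := eval_orbitCoordToPoly_mul_left f m hx hsU g
  have hcoe : ((s : GL σ k) : Matrix σ σ k) * (g : Matrix σ σ k) = t • (g : Matrix σ σ k) := by
    rw [hs, Literature.Computability.AlgebraicComplexity.coe_torusElt, ← Matrix.smul_one_eq_diagonal, smul_mul_assoc, one_mul]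
  have hwc : weightChar χ s = t ^ (-(D : ℤ)) := by
    rw [hs, Literature.Computability.AlgebraicComplexity.weightChar_torusElt, prod_zpow_eq_zpow_sum ht, ← hsize]
    rfl
  rw [hcoe, hwc, zpow_neg, inv_inv, zpow_natCast] at h
  exact h

variable (χ : Weight σ)

/-- The restriction of `orbitCoordToPoly` to the highest-weight space of weight `χ`, a
`k`-linear injection `HW_χ(k[Δ_m[f]]) ↪ k[Mat_σ]`. [folklore] -/
def hwToPoly [Infinite k] : highestWeightSpace (Literature.Computability.AlgebraicComplexity.orbitCoordRep f m) χ →ₗ[k] MvPolynomial (σ × σ) k :=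
  (orbitCoordToPoly f m).toLinearMap ∘ₗ (highestWeightSpace (Literature.Computability.AlgebraicComplexity.orbitCoordRep f m) χ).subtype

/-- Unfolding lemma for `hwToPoly`. [folklore] -/
theorem hwToPoly_apply [Infinite k] (x : highestWeightSpace (Literature.Computability.AlgebraicComplexity.orbitCoordRep f m) χ) :
    hwToPoly f m χ x = orbitCoordToPoly f m x :=
  rfl

/-- `hwToPoly` is injective. [folklore] -/
theorem hwToPoly_injective [Infinite k] : Function.Injective (hwToPoly f m χ) :=
  (orbitCoordToPoly_injective f m).comp Subtype.val_injective

end OrbitToPoly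

/-! ### §2 Transport along an order isomorphism `Fin N ≃o σ` -/

section Transport

variable {σ k : Type*} [Fintype σ] [LinearOrder σ] [Field k] {N : ℕ} (e : Fin N ≃o σ)

/-- Reindexing invertible matrices along an order isomorphism `e : Fin N ≃o σ`:
`g ↦ (e⁻¹ i, e⁻¹ j) ↦ g`, i.e. `reindex e e`, a group homomorphism `GL_N(k) → GL_σ(k)`
(Mathlib's `Matrix.reindexAlgEquiv` on units). [folklore] -/
def reindexGL : GL (Fin N) k →* GL σ k :=
  Units.map (MonoidHomClass.toMonoidHom (Matrix.reindexAlgEquiv k k e.toEquiv))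

/-- The matrix of `reindexGL e g` is `reindex e e g` (unfolding lemma). [folklore] -/
@[simp]
theorem coe_reindexGL (g : GL (Fin N) k) :
    ((reindexGL e g : GL σ k) : Matrix σ σ k) =
      (g : Matrix (Fin N) (Fin N) k).submatrix e.symm e.symm :=
  rfl

/-- Reindexing along an order isomorphism preserves upper triangularity. [folklore] -/
theorem isUpperTriangular_reindexGL {g : GL (Fin N) k} (hg : IsUpperTriangular g) :
    IsUpperTriangular (reindexGL e g) := by
  intro i j hij
  rw [coe_reindexGL, Matrix.submatrix_apply]
  exact hg.apply_eq_zero (e.symm.lt_iff_lt.mpr hij)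

/-- Weight characters under reindexing: `χ(reindex g) = (χ ∘ e)(g)`. [folklore] -/
theorem weightChar_reindexGL (χ : Weight σ) (g : GL (Fin N) k) :
    weightChar χ (reindexGL e g) = weightChar (χ ∘ e) g := by
  unfold weightChar
  simp only [coe_reindexGL, Matrix.submatrix_apply, Function.comp_apply]
  exact Fintype.prod_equiv e.symm.toEquiv _ _ fun i => by simp

/-- Transport of a polynomial on `Mat_σ` to a polynomial on `Mat_N` along `e`:
`P ↦ P ∘ reindex`, i.e. renaming the variable `X_{(i,j)}` to `X_{(e⁻¹ i, e⁻¹ j)}`. [folklore] -/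
def transportPoly : MvPolynomial (σ × σ) k →ₐ[k] MvPolynomial (Fin N × Fin N) k :=
  rename fun ij : σ × σ => (e.symm ij.1, e.symm ij.2)

omit [Fintype σ] in
/-- Values of the transported polynomial: `(transportPoly e P)(A) = P(reindex e e A)`. [folklore] -/
theorem eval_transportPoly (P : MvPolynomial (σ × σ) k) (A : Matrix (Fin N) (Fin N) k) :
    eval (fun ij : Fin N × Fin N => A ij.1 ij.2) (transportPoly e P) =
      eval (fun ij : σ × σ => (A.submatrix e.symm e.symm) ij.1 ij.2) P := by
  rw [transportPoly, eval_rename]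
  rfl

omit [Fintype σ] in
/-- `transportPoly` is injective (renaming along an injection). [folklore] -/
theorem transportPoly_injective : Function.Injective (transportPoly (k := k) e) :=
  rename_injective _ fun ij ij' h => by
    simp only [Prod.mk.injEq, EmbeddingLike.apply_eq_iff_eq] at h
    exact Prod.ext h.1 h.2

omit [Fintype σ] in
/-- `transportPoly` preserves homogeneity. [folklore] -/
theorem isHomogeneous_transportPoly {P : MvPolynomial (σ × σ) k} {D : ℕ} (hP : P.IsHomogeneous D) :
    (transportPoly e P).IsHomogeneous D :=
  hP.rename_isHomogeneous

/-- Transport of left semi-invariance: if `P(b g) = χ(b)⁻¹ P(g)` on `GL_σ` then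
`P'(b' g') = (χ∘e)(b')⁻¹ P'(g')` on `GL_N`. [folklore] -/
theorem eval_transportPoly_mul_left (P : MvPolynomial (σ × σ) k) (χ : Weight σ)
    (hP : ∀ b : GL σ k, IsUpperTriangular b → ∀ g : GL σ k,
      eval (fun ij : σ × σ => ((b : Matrix σ σ k) * (g : Matrix σ σ k)) ij.1 ij.2) P =
        (weightChar χ b)⁻¹ * eval (fun ij : σ × σ => (g : Matrix σ σ k) ij.1 ij.2) P)
    (b : GL (Fin N) k) (hb : IsUpperTriangular b) (g : GL (Fin N) k) :
    eval (fun ij : Fin N × Fin N =>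
        ((b : Matrix (Fin N) (Fin N) k) * (g : Matrix (Fin N) (Fin N) k)) ij.1 ij.2) (transportPoly e P) =
      (weightChar (χ ∘ e) b)⁻¹ *
        eval (fun ij : Fin N × Fin N => (g : Matrix (Fin N) (Fin N) k) ij.1 ij.2) (transportPoly e P) := by
  rw [eval_transportPoly, eval_transportPoly, ← Matrix.submatrix_mul_equiv _ _ _ e.symm.toEquiv _,
    ← weightChar_reindexGL]
  exact hP (reindexGL e b) (isUpperTriangular_reindexGL e hb) (reindexGL e g)

/-- Transport of right invariance: if `P(g h) = P(g)` with `h = reindex e e h'` then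
`P'(g' h') = P'(g')`. [folklore] -/
theorem eval_transportPoly_mul_right (P : MvPolynomial (σ × σ) k) (h : GL (Fin N) k)
    (hP : ∀ g : GL σ k,
      eval (fun ij : σ × σ => ((g : Matrix σ σ k) * ((reindexGL e h : GL σ k) : Matrix σ σ k)) ij.1 ij.2)
          P =
        eval (fun ij : σ × σ => (g : Matrix σ σ k) ij.1 ij.2) P)
    (g : GL (Fin N) k) :
    eval (fun ij : Fin N × Fin N =>
        ((g : Matrix (Fin N) (Fin N) k) * (h : Matrix (Fin N) (Fin N) k)) ij.1 ij.2) (transportPoly e P) =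
      eval (fun ij : Fin N × Fin N => (g : Matrix (Fin N) (Fin N) k) ij.1 ij.2) (transportPoly e P) := by
  rw [eval_transportPoly, eval_transportPoly, ← Matrix.submatrix_mul_equiv _ _ _ e.symm.toEquiv _]
  exact hP (reindexGL e g)

end Transport

/-! ### §3 The bound space of invariant coefficient matrices -/

section Bound

variable (k : Type*) [Field k] {N D : ℕ} (χ : Weight (Fin N)) (X : Submodule k (Word N D → k))

/-- The **bound space** `T`: `𝔖_D`-invariant coefficient matrices `L` (pairs of words of length `D`
in the alphabet `Fin N`) all of whose columns lie in the transposed weight space of weight `χ`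
and all of whose rows lie in `X`. For `X` the vectors fixed by a family of stabilizing elements,
`dim T` bounds the multiplicity of `χ` in the coordinate ring of the orbit closure
(`finrank_highestWeightSpace_orbitCoordRep_le`); it is the space `(Y ⊗ X)^{𝔖_D}` of
BLMW's `dim (S_πW)^{H}` computation. BLMW 2011 §5.2. [cite: BLMW2011, §5.2] -/
def boundSpace : Submodule k (Matrix (Word N D) (Word N D) k) where
  carrier := {L | IsPermInvariant L ∧ (∀ J, (fun I => L I J) ∈ transposedWeightSpace k N D χ) ∧
    ∀ I, (fun J => L I J) ∈ X}
  add_mem' hL hL' := ⟨hL.1.add hL'.1, fun J => Submodule.add_mem _ (hL.2.1 J) (hL'.2.1 J),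
    fun I => Submodule.add_mem _ (hL.2.2 I) (hL'.2.2 I)⟩
  zero_mem' := ⟨isPermInvariant_zero, fun _ => Submodule.zero_mem _, fun _ => Submodule.zero_mem _⟩
  smul_mem' c _ hL := ⟨hL.1.smul c, fun J => Submodule.smul_mem _ c (hL.2.1 J),
    fun I => Submodule.smul_mem _ c (hL.2.2 I)⟩

variable {χ X}

/-- Membership in the bound space (unfolding lemma). [folklore] -/
theorem mem_boundSpace_iff (L : Matrix (Word N D) (Word N D) k) :
    L ∈ boundSpace k χ X ↔ IsPermInvariant L ∧
      (∀ J, (fun I => L I J) ∈ transposedWeightSpace k N D χ) ∧ ∀ I, (fun J => L I J) ∈ X :=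
  Iff.rfl

/-- Columns of `Aᵀ L` are the word-model action of `Aᵀ` on the columns of `L`:
`((A^{⊗D})ᵀ L)_{I J} = (Aᵀ · L_{·J})_I`. [folklore] -/
theorem kronPow_transpose_mul_apply (b : GL (Fin N) k) (L : Matrix (Word N D) (Word N D) k)
    (I J : Word N D) :
    ((kronPow (D := D) (b : Matrix (Fin N) (Fin N) k))ᵀ * L) I J =
      wordRep k N D (transposeGL k b) (fun I' => L I' J) I := by
  rw [Matrix.mul_apply, wordRep_apply]
  refine Finset.sum_congr rfl fun K _ => ?_
  rw [Matrix.transpose_apply, kronPow_apply, coe_transposeGL]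
  rfl

/-- Rows of `L Aᵀ` are the word-model action of `A` on the rows of `L`:
`(L (A^{⊗D})ᵀ)_{I J} = (A · L_{I ·})_J`. [folklore] -/
theorem mul_kronPow_transpose_apply (h : GL (Fin N) k) (L : Matrix (Word N D) (Word N D) k)
    (I J : Word N D) :
    (L * (kronPow (D := D) (h : Matrix (Fin N) (Fin N) k))ᵀ) I J =
      wordRep k N D h (fun J' => L I J') J := by
  rw [Matrix.mul_apply, wordRep_apply]
  refine Finset.sum_congr rfl fun K _ => ?_
  rw [Matrix.transpose_apply, kronPow_apply, mul_comm]

/-- **Semi-invariant homogeneous polynomials come from the bound space** (characteristic zero):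
a homogeneous `P` of degree `D` on `Mat_N` with `P(b g) = χ(b)⁻¹ P(g)` (`b ∈ B`) and
`P(g h) = P(g)` for all `h` of a family `S` whose common fixed vectors lie in `X` is
`pairPoly L` for some `L ∈ boundSpace χ X`: take `L` invariant
(`exists_isPermInvariant_pairPoly_eq`); the translation identities
(`kronPow_transpose_mul_eq_of_eval_mul_left`, `mul_kronPow_transpose_eq_of_eval_mul_right`) say
that the columns are `Bᵀ`-semi-invariant and the rows `S`-fixed. Fulton–Harris Lemma 6.23;
BLMW 2011 §5.2. [folklore] -/
theorem exists_mem_boundSpace [CharZero k] (P : MvPolynomial (Fin N × Fin N) k)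
    (hhom : P.IsHomogeneous D)
    (hleft : ∀ b : GL (Fin N) k, IsUpperTriangular b → ∀ g : GL (Fin N) k,
      eval (fun ij : Fin N × Fin N =>
          ((b : Matrix (Fin N) (Fin N) k) * (g : Matrix (Fin N) (Fin N) k)) ij.1 ij.2) P =
        (weightChar χ b)⁻¹ * eval (fun ij : Fin N × Fin N => (g : Matrix (Fin N) (Fin N) k) ij.1 ij.2) P)
    (S : GL (Fin N) k → Prop)
    (hSX : ∀ x : Word N D → k, (∀ h, S h → wordRep k N D h x = x) → x ∈ X)
    (hright : ∀ h, S h → ∀ g : GL (Fin N) k,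
      eval (fun ij : Fin N × Fin N =>
          ((g : Matrix (Fin N) (Fin N) k) * (h : Matrix (Fin N) (Fin N) k)) ij.1 ij.2) P =
        eval (fun ij : Fin N × Fin N => (g : Matrix (Fin N) (Fin N) k) ij.1 ij.2) P) :
    ∃ L ∈ boundSpace k χ X, pairPoly k (Fin N) D L = P := by
  obtain ⟨L, hL, rfl⟩ := exists_isPermInvariant_pairPoly_eq P hhom
  refine ⟨L, ⟨hL, fun J => ?_, fun I => ?_⟩, rfl⟩
  · intro b hb
    have h := kronPow_transpose_mul_eq_of_eval_mul_left hL (b : Matrix (Fin N) (Fin N) k)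
      (weightChar χ b)⁻¹ (hleft b hb)
    funext I
    have hIJ := congr_fun (congr_fun h I) J
    rw [kronPow_transpose_mul_apply] at hIJ
    rw [hIJ]
    rfl
  · apply hSX
    intro h hh
    have h' := mul_kronPow_transpose_eq_of_eval_mul_right hL (h : Matrix (Fin N) (Fin N) k)
      (hright h hh)
    funext J
    have hIJ := congr_fun (congr_fun h' I) J
    rwa [mul_kronPow_transpose_apply] at hIJ

variable (χ X)
variable (hX : ∀ τ : Equiv.Perm (Fin D), X ≤ X.comap (wordPermRep k N D τ))

/-- The transposed weight space is `𝔖_D`-stable (for use as `hY` in `sliceRep`). [folklore] -/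
theorem transposedWeightSpace_le_comap (τ : Equiv.Perm (Fin D)) :
    transposedWeightSpace k N D χ ≤ (transposedWeightSpace k N D χ).comap (wordPermRep k N D τ) :=
  fun _ hy => wordPerm_mem_transposedWeightSpace k τ hy

/-- **`T ≅ (Y ⊗ X)^{𝔖_D}`**: the bound space is linearly isomorphic to the `𝔖_D`-invariants of the
slice representation on functions of pairs of words with columns in the transposed weight space
`Y` and rows in `X` (uncurrying; invariance of `L` is invariance under the simultaneous
permutation of positions, `pairRep_wordPermRep_apply`). [folklore] -/
def boundSpaceEquivInvariants :
    boundSpace k χ X ≃ₗ[k]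
      (sliceRep (transposedWeightSpace_le_comap k χ) hX).invariants where
  toFun L := ⟨⟨fun p => L.1 p.1 p.2, ⟨fun J => L.2.2.1 J, fun I => L.2.2.2 I⟩⟩, by
    rw [Representation.mem_invariants]
    intro τ
    apply Subtype.ext
    rw [coe_sliceRep_apply, pairRep_wordPermRep_apply]
    funext p
    exact L.2.1.apply_comp τ p.1 p.2⟩
  invFun M := ⟨fun I J => ((M : sliceSubmodule (transposedWeightSpace k N D χ) X) : _ → k) (I, J),
    ⟨fun τ => by
      ext I J
      have h := (Representation.mem_invariants _ _).mp M.2 τ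
      have h' := congr_fun (congrArg Subtype.val h) (I, J)
      rw [coe_sliceRep_apply, pairRep_wordPermRep_apply, pairPermAct_apply] at h'
      exact h',
      fun J => (M : sliceSubmodule (transposedWeightSpace k N D χ) X).2.1 J,
      fun I => (M : sliceSubmodule (transposedWeightSpace k N D χ) X).2.2 I⟩⟩
  map_add' _ _ := rfl
  map_smul' _ _ := rfl
  left_inv L := rfl
  right_inv M := rfl

/-- **Counting the bound space**: `D! · dim T = ∑_{τ ∈ 𝔖_D} χ_Y(τ) χ_X(τ)` in `k`, where `χ_Y` is
the character of `𝔖_D` on the transposed weight space of weight `χ` and `χ_X` its character on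
`X` (`card_mul_finrank_invariants_sliceRep`; Fulton–Harris (2.9) with Prop. 2.1).
[cite: FultonHarrisGTM129, §2.2 (2.9)] -/
theorem card_mul_finrank_boundSpace [CharZero k] :
    ((Fintype.card (Equiv.Perm (Fin D)) : ℕ) : k) * (Module.finrank k (boundSpace k χ X) : k) =
      ∑ τ : Equiv.Perm (Fin D), (transposedPermRep k (D := D) χ).character τ *
        ((wordPermRep k N D).subrepresentation X hX).character τ := by
  haveI : Invertible (Nat.card (Equiv.Perm (Fin D)) : k) :=
    invertibleOfNonzero (by rw [Nat.card_eq_fintype_card]; exact Nat.cast_ne_zero.mpr Fintype.card_ne_zero)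
  rw [(boundSpaceEquivInvariants k χ X hX).finrank_eq, ← Nat.card_eq_fintype_card]
  exact card_mul_finrank_invariants_sliceRep (transposedWeightSpace_le_comap k χ) hX

end Bound

/-! ### §3' The multiplicity bound for a general form -/

section GeneralBound

variable {σ k : Type*} [Fintype σ] [LinearOrder σ] [Field k]

/-- **The multiplicity of `χ` in `k[Δ_m[f]]` is at most `dim T`** (characteristic zero). Here
`e : Fin N ≃o σ`, `∑ χ = -D`, `X ≤ k^{words}` is `𝔖_D`-stable and contains every vector fixed by
a family `S ⊆ GL_N(k)` whose elements (reindexed) stabilise `f`, and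
`T = boundSpace (χ ∘ e) X`: the injection `HW_χ(k[Δ_m[f]]) ↪ k[Mat_N]`
(`hwToPoly`, `transportPoly`) lands in `pairPoly(T)` (`exists_mem_boundSpace`).
BLMW 2011 §5.2 ("`mult_π ℂ[\overline{GL·x}]_δ ≤ mult_π ℂ[GL·x] = dim (S_πW)^{GL(x)}`",
with `GL(x)` replaced by a subgroup). [cite: BLMW2011, §5.2 Prop. 5.2.1] -/
theorem finrank_highestWeightSpace_orbitCoordRep_le [CharZero k] (f : MvPolynomial σ k) (m : ℕ)
    (χ : Weight σ) {N D : ℕ} (e : Fin N ≃o σ) (hsize : χ.size = -(D : ℤ))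
    (X : Submodule k (Word N D → k)) (S : GL (Fin N) k → Prop)
    (hSX : ∀ x : Word N D → k, (∀ h, S h → wordRep k N D h x = x) → x ∈ X)
    (hSf : ∀ h, S h → Literature.Computability.AlgebraicComplexity.linSubstRep σ k (reindexGL e h) f = f) :
    Module.finrank k (highestWeightSpace (Literature.Computability.AlgebraicComplexity.orbitCoordRep f m) χ) ≤
      Module.finrank k (boundSpace k (χ ∘ e) X) := by
  -- the injection `HW_χ(k[Δ]) → k[Mat_N]`
  set Γ : highestWeightSpace (Literature.Computability.AlgebraicComplexity.orbitCoordRep f m) χ →ₗ[k] MvPolynomial (Fin N × Fin N) k :=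
    (transportPoly (k := k) e).toLinearMap ∘ₗ hwToPoly f m χ with hΓ
  have hΓinj : Function.Injective Γ :=
    (transportPoly_injective e).comp (hwToPoly_injective f m χ)
  -- its range lies in `pairPoly (boundSpace)`
  have hrange : LinearMap.range Γ ≤ (boundSpace k (χ ∘ e) X).map (pairPoly k (Fin N) D) := by
    rintro _ ⟨x, rfl⟩
    obtain ⟨F, hF⟩ := Ideal.Quotient.mk_surjective (x : Literature.Computability.AlgebraicComplexity.OrbitCoordRing f m)
    have hx : Ideal.Quotient.mk (Literature.Computability.AlgebraicComplexity.orbitVanishingIdeal f m) F ∈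
        highestWeightSpace (Literature.Computability.AlgebraicComplexity.orbitCoordRep f m) χ := by rw [hF]; exact x.2
    have hΓx : Γ x = transportPoly e (orbitCoordToPoly f m (Ideal.Quotient.mk _ F)) := by
      rw [hΓ, LinearMap.comp_apply, hwToPoly_apply, hF]
      rfl
    obtain ⟨L, hL, hLP⟩ := exists_mem_boundSpace k (χ := χ ∘ e) (X := X)
      (transportPoly e (orbitCoordToPoly f m (Ideal.Quotient.mk _ F)))
      (isHomogeneous_transportPoly e (isHomogeneous_orbitCoordToPoly f m hx hsize))
      (eval_transportPoly_mul_left e _ χ fun b hb g => eval_orbitCoordToPoly_mul_left f m hx hb g)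
      S hSX
      (fun h hh => eval_transportPoly_mul_right e _ h fun g =>
        eval_orbitCoordToPoly_mul_right f m F (hSf h hh) g)
    exact ⟨L, hL, by rw [hLP, hΓx]⟩
  calc Module.finrank k (highestWeightSpace (Literature.Computability.AlgebraicComplexity.orbitCoordRep f m) χ)
      = Module.finrank k (LinearMap.range Γ) := (LinearMap.finrank_range_of_inj hΓinj).symm
    _ ≤ Module.finrank k ((boundSpace k (χ ∘ e) X).map (pairPoly k (Fin N) D)) :=
        Submodule.finrank_mono hrange
    _ ≤ Module.finrank k (boundSpace k (χ ∘ e) X) := Submodule.finrank_map_le _ _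

end GeneralBound

/-! ### §4 The determinant -/

section Determinant

variable (k : Type*) [Field k] (m : ℕ)

/-- The Kronecker product `a ⊗ b`, reindexed along `matIdxEquiv m : Fin (m*m) ≃o MatIdx m`, is the
lexicographically reindexed Kronecker matrix `reindex toLex toLex (a ⊗ₖ b)`. [folklore] -/
theorem coe_reindexGL_kronFin (a b : GL (Fin m) k) :
    ((reindexGL (k := k) (matIdxEquiv m) (kronFin k m a b) : GL (MatIdx m) k) :
        Matrix (MatIdx m) (MatIdx m) k) =
      Matrix.reindex toLex toLex ((a : Matrix (Fin m) (Fin m) k) ⊗ₖ (b : Matrix (Fin m) (Fin m) k)) := by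
  ext i j
  rw [coe_reindexGL, Matrix.submatrix_apply, coe_kronFin, kronFinMat_apply, Matrix.reindex_apply,
    Matrix.submatrix_apply, Matrix.kroneckerMap_apply]
  have hi : ∀ x : MatIdx m, finProdFinEquiv.symm ((matIdxEquiv m).symm x) = toLex.symm x := by
    intro x
    change finProdFinEquiv.symm (finProdFinEquiv (toLex.symm x)) = toLex.symm x
    rw [Equiv.symm_apply_apply]
  rw [hi, hi]

/-- **`a ⊗ b` stabilises `det_m`** (as the form `detFormLex k m` in the lexicographic variables)
when `det a = det b = 1`: transport of `linSubst_kronecker_detPoly` along `rename toLex`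
(`rename_linSubst`). BLMW 2011 §5.2 (`S(GL(E) × GL(F)) ⊂ GL(W)(det_n)`). [cite: BLMW2011, §5.2] -/
theorem linSubstRep_reindexGL_kronFin_detFormLex {a b : GL (Fin m) k}
    (ha : (a : Matrix (Fin m) (Fin m) k).det = 1) (hb : (b : Matrix (Fin m) (Fin m) k).det = 1) :
    Literature.Computability.AlgebraicComplexity.linSubstRep (MatIdx m) k (reindexGL (k := k) (matIdxEquiv m) (kronFin k m a b)) (detFormLex k m) =
      detFormLex k m := by
  rw [Literature.Computability.AlgebraicComplexity.linSubstRep_apply, coe_reindexGL_kronFin, detFormLex]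
  have h := rename_linSubst (toLex : (Fin m × Fin m) ≃ MatIdx m)
    ((a : Matrix (Fin m) (Fin m) k) ⊗ₖ (b : Matrix (Fin m) (Fin m) k)) (Literature.Computability.AlgebraicComplexity.detPoly (Fin m) k)
  rw [linSubst_kronecker_detPoly, ha, hb, mul_one, one_smul] at h
  exact h.symm

/-- The family of stabilizing elements used: `a ⊗ b` with `a, b` upper triangular unimodular.
BLMW 2011 §5.2. [folklore] -/
def IsKronUnimodularBorel (h : GL (Fin (m * m)) k) : Prop :=
  ∃ a b : GL (Fin m) k, IsUpperTriangular a ∧ (a : Matrix (Fin m) (Fin m) k).det = 1 ∧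
    IsUpperTriangular b ∧ (b : Matrix (Fin m) (Fin m) k).det = 1 ∧ h = kronFin k m a b

/-- Vectors fixed by the family `IsKronUnimodularBorel` lie in `kronInvariants`. [folklore] -/
theorem mem_kronInvariants_of_forall {D : ℕ} (x : Word (m * m) D → k)
    (hx : ∀ h, IsKronUnimodularBorel k m h → wordRep k (m * m) D h x = x) :
    x ∈ kronInvariants k m D :=
  fun a b ha ha1 hb hb1 => hx _ ⟨a, b, ha, ha1, hb, hb1, rfl⟩

/-- The transported weight: `λ*.toMatIdx ∘ matIdxEquiv = λ*`. [folklore] -/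
theorem toMatIdx_comp_matIdxEquiv (χ₀ : Weight (Fin (m * m))) :
    (χ₀.toMatIdx : Weight (MatIdx m)) ∘ (matIdxEquiv m) = χ₀ := by
  funext n
  change χ₀ ((matIdxEquiv m).symm (matIdxEquiv m n)) = χ₀ n
  rw [OrderIso.symm_apply_apply]

/-- The size of the transported dual weight of `λ ⊢ m d` (at most `m²` parts) is `-(m d)`.
[folklore] -/
theorem size_toMatIdx_dualOfPartition {d : ℕ} (lam : Nat.Partition (m * d))
    (hlam : lam.parts.card ≤ m * m) :
    ((Weight.dualOfPartition (m * m) lam).toMatIdx : Weight (MatIdx m)).size = -((m * d : ℕ) : ℤ) := by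
  have hsize : ((Weight.dualOfPartition (m * m) lam).toMatIdx : Weight (MatIdx m)).size =
      (Weight.dualOfPartition (m * m) lam).size := by
    unfold Weight.size
    exact Fintype.sum_equiv (matIdxEquiv m).symm.toEquiv _ _ fun _ => rfl
  rw [hsize, Weight.dualOfPartition, Weight.size_dual, Weight.size_ofPartition_holds hlam]

/-- **Discharge** of the named fact `orbitMultiplicity_det_le_kroneckerCoeff` (BLMW 2011, §5.2,
Prop. 5.2.1 = arXiv:0907.2850 Prop. 5.1:
"`ℂ[\overline{GL(W)·det_n}]_δ ⊆ ⊕_{|π| = nδ} (S_πW^*)^{⊕ k_{δ^n,δ^n,π}}`"): over any field of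
characteristic zero, for `λ ⊢ m·d` with at most `m²` parts, the multiplicity of the highest weight
`(Weight.dualOfPartition (m*m) λ).toMatIdx` in `k[Δ(det_m)]` is at most
`kroneckerCoeff k λ (m × d) (m × d)`. Proof: §1–§3 give `mult ≤ dim T` with
`D! · dim T = ∑_τ χ^λ(τ) χ^□(τ)²` (`character_transposedPermRep_dualOfPartition`,
`character_kronInvariantsPermRep`), and `∑_τ χ^λ χ^□ χ^□ = D! · g(λ, □, □)`
(`kroneckerCoeff_eq_sum_spechtCharacter_holds`); see the module docstring.
[cite: BLMW2011, §5.2 Prop. 5.2.1] -/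
theorem orbitMultiplicity_det_le_kroneckerCoeff_holds :
    orbitMultiplicity_det_le_kroneckerCoeff (k := k) := by
  intro _ m d lam hlam
  set χ₀ : Weight (Fin (m * m)) := Weight.dualOfPartition (m * m) lam with hχ₀
  set X : Submodule k (Word (m * m) (m * d) → k) := kronInvariants k m (m * d) with hXdef
  have hX : ∀ τ : Equiv.Perm (Fin (m * d)), X ≤ X.comap (wordPermRep k (m * m) (m * d) τ) :=
    fun τ _ hx => wordPerm_mem_kronInvariants k m τ hx
  -- §1–§3: the multiplicity is at most `dim T`
  have hle := finrank_highestWeightSpace_orbitCoordRep_le (detFormLex k m) m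
    (χ₀.toMatIdx : Weight (MatIdx m)) (matIdxEquiv m) (size_toMatIdx_dualOfPartition m lam hlam)
    X (IsKronUnimodularBorel k m) (mem_kronInvariants_of_forall k m)
    (fun h hh => by
      obtain ⟨a, b, ha, ha1, hb, hb1, rfl⟩ := hh
      exact linSubstRep_reindexGL_kronFin_detFormLex k m ha1 hb1)
  rw [toMatIdx_comp_matIdxEquiv] at hle
  -- §3–§4: `D! · dim T = ∑ χ^λ (χ^□)² = D! · g(λ, □, □)`
  have hcount := card_mul_finrank_boundSpace k χ₀ X hX
  rw [Fintype.card_perm, Fintype.card_fin, hχ₀,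
    character_transposedPermRep_dualOfPartition k lam hlam] at hcount
  have hchar : ((wordPermRep k (m * m) (m * d)).subrepresentation X hX).character =
      spechtCharacter k (Nat.Partition.rectangle m d) * spechtCharacter k (Nat.Partition.rectangle m d) :=
    character_kronInvariantsPermRep k d
  rw [hchar] at hcount
  have hkron := kroneckerCoeff_eq_sum_spechtCharacter_holds k lam (Nat.Partition.rectangle m d)
    (Nat.Partition.rectangle m d)
  have heq : ((Module.finrank k (boundSpace k χ₀ X) : ℕ) : k) =
      (kroneckerCoeff k lam (Nat.Partition.rectangle m d) (Nat.Partition.rectangle m d) : k) := by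
    have hfact : (((m * d).factorial : ℕ) : k) ≠ 0 := Nat.cast_ne_zero.mpr (Nat.factorial_ne_zero _)
    apply mul_left_cancel₀ hfact
    rw [hcount, ← Nat.cast_mul, hkron]
    refine Finset.sum_congr rfl fun τ _ => ?_
    rw [Pi.mul_apply]
    ring
  have heq' := Nat.cast_injective (R := k) heq
  calc orbitMultiplicity k (detFormLex k m) m χ₀.toMatIdx
      = Module.finrank k (highestWeightSpace (Literature.Computability.AlgebraicComplexity.orbitCoordRep (detFormLex k m) m) χ₀.toMatIdx) := rfl
    _ ≤ Module.finrank k (boundSpace k χ₀ X) := hle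
    _ = kroneckerCoeff k lam (Nat.Partition.rectangle m d) (Nat.Partition.rectangle m d) := heq'

end Determinant

end Literature.NumberTheory.DiophantineGeometry
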